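import Mathlib
import HarnessLib

/-!
# Sums of a smooth periodic function over the reduced residues `a/c`

Topic `Literature/NumberTheory/LFunctions` (trunk T-ANT). Support file of the elementary proof of
the named fact `Literature.NumberTheory.LFunctions.zagier_horocycle_rate_half` (`HorocycleRH.lean`; Sarnak 1981, Thm. 1):
after unfolding, the closed-horocycle average is `2y ∑_c ∑_{a mod c, (a,c)=1} Ψ(c²y, a/c)` for a
smooth `1`-periodic `θ ↦ Ψ(w, θ) = ∑_k b_k(w) e(kθ)`, and this file evaluates the inner sums.
Everything here is PROVED; there are no named facts.

* `sum_range_exp_eq`: `∑_{b mod m} e(kb/m) = m·[m ∣ k]`.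
* `sum_range_eq_mul_tsum`: if `h(θ) = ∑_k b_k e(kθ)` pointwise, `∑_{r mod m} h(r/m) = m ∑_j b_{jm}`.
* `sum_coprime_eq`: `∑_{a mod c}^* h(a/c) = ∑_{d ∣ c} μ(d) (c/d) ∑_j b_{j c/d}` — Möbius inversion
  of the coprimality condition; with `b_k` in place of `e(k·)` this is the evaluation of the
  Ramanujan sums `S(k,0;c) = ∑_{δ ∣ (c,k)} μ(c/δ) δ` (Iwaniec, *Spectral methods*, (2.26);
  Hardy–Wright Thm. 271).
* `norm_sum_coprime_sub_le`: if moreover `‖b_k‖ ≤ M/|k|³` (`k ≠ 0`), then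
  `‖∑_{a mod c}^* h(a/c) - φ(c) b_0‖ ≤ 8M` uniformly in `c ≥ 1`
  (`∑_{d ∣ c} (c/d) ∑_{j ≠ 0} M/(|j| c/d)³ ≤ 4M ∑_{e ∣ c} e⁻² ≤ 8M`).

## References

* H. Iwaniec, *Spectral Methods of Automorphic Forms*, 2nd ed., AMS GSM 53 (2002), (2.26)
  [Iwaniec2002].
* G. H. Hardy, E. M. Wright, *An Introduction to the Theory of Numbers*, 6th ed. (2008), Thm. 271
  [HardyWright2008].

## Mathlib search

`ArithmeticFunction.coe_zeta_mul_coe_moebius`, `ArithmeticFunction.sum_eq_iff_sum_smul_moebius_eq`,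
`Nat.sum_totient`, `Nat.sum_div_divisors`, `geom_sum_eq`, `Real.summable_one_div_int_pow`,
`tsum_of_nat_of_neg_add_one`. Mathlib has no Ramanujan sums. Tree: `Literature.NumberTheory.Sieve.ramanujanSum`,
`Literature.sum_range_fourierChar_div`, `Literature.NumberTheory.Sieve.ramanujanSum_eq_ramanujanDivisorSum`
(`Literature/NumberTheory/Sieve/RamanujanSum.lean`, phrased with `Real.fourierChar`); here the sums
are over the Fourier coefficients `b_k` of an arbitrary summable series (phrased with `Complex.exp`),
which that file does not cover, and only the elementary complete-sum identity is re-derived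
(`sum_range_exp_eq`, five lines via `geom_sum_eq`).
-/

noncomputable section

open Real Complex MeasureTheory Set Filter Finset

namespace Literature.NumberTheory.LFunctions

namespace CoprimeResidueSums

open scoped ArithmeticFunction.Moebius

/-- The complete exponential sum over residues: `∑_{b mod m} e(k b/m) = m [m ∣ k]`. [folklore] -/
theorem sum_range_exp_eq (m : ℕ) (hm : 0 < m) (k : ℤ) :
    ∑ b ∈ Finset.range m, Complex.exp (2 * π * I * k * b / m) =
      if (m : ℤ) ∣ k then (m : ℂ) else 0 := by
  have hm' : (m : ℂ) ≠ 0 := by exact_mod_cast hm.ne'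
  split_ifs with hdvd
  · obtain ⟨j, rfl⟩ := hdvd
    have : ∀ b ∈ Finset.range m, Complex.exp (2 * π * I * ((m * j : ℤ) : ℂ) * b / m) = 1 := by
      intro b _
      rw [Complex.exp_eq_one_iff]
      refine ⟨j * b, ?_⟩
      push_cast
      field_simp
    rw [Finset.sum_congr rfl this]
    simp
  · set ω : ℂ := Complex.exp (2 * π * I * k / m) with hω
    have hpow : ∀ b : ℕ, Complex.exp (2 * π * I * k * b / m) = ω ^ b := fun b => by
      rw [hω, ← Complex.exp_nat_mul]
      congr 1
      ring
    have hω1 : ω ≠ 1 := by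
      intro h
      rw [hω, Complex.exp_eq_one_iff] at h
      obtain ⟨n, hn⟩ := h
      apply hdvd
      refine ⟨n, ?_⟩
      have h2 : (2 * π * I : ℂ) ≠ 0 := by
        simp [Real.pi_ne_zero, Complex.I_ne_zero]
      have : (k : ℂ) = m * n := by
        field_simp at hn
        linear_combination hn
      exact_mod_cast this
    have hωm : ω ^ m = 1 := by
      rw [hω, ← Complex.exp_nat_mul, Complex.exp_eq_one_iff]
      exact ⟨k, by field_simp⟩
    simp_rw [hpow]
    rw [geom_sum_eq hω1, hωm, sub_self, zero_div]


/-- **Complete residue systems pick out the Fourier modes divisible by the modulus**: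
if `h(θ) = ∑_k b_k e(kθ)` pointwise then `∑_{r mod m} h(r/m) = m ∑_j b_{jm}`. [folklore] -/
theorem sum_range_eq_mul_tsum {b : ℤ → ℂ} {h : ℝ → ℂ}
    (hh : ∀ θ : ℝ, HasSum (fun k : ℤ => b k * Complex.exp (2 * π * I * k * θ)) (h θ))
    {m : ℕ} (hm : 0 < m) :
    ∑ r ∈ Finset.range m, h (r / m) = m * ∑' j : ℤ, b (j * m) := by
  classical
  have hm' : (m : ℂ) ≠ 0 := by exact_mod_cast hm.ne'
  set g : ℤ → ℂ := fun k => if (m : ℤ) ∣ k then b k else 0 with hg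
  have H : HasSum (fun k : ℤ => ∑ r ∈ Finset.range m, b k * Complex.exp (2 * π * I * k * (r / m : ℝ)))
      (∑ r ∈ Finset.range m, h (r / m)) :=
    hasSum_sum fun r _ => hh (r / m)
  have H' : HasSum (fun k : ℤ => (m : ℂ) * g k) (∑ r ∈ Finset.range m, h (r / m)) := by
    refine H.congr_fun fun k => ?_
    rw [← Finset.mul_sum]
    have : ∑ r ∈ Finset.range m, Complex.exp (2 * π * I * k * (r / m : ℝ)) =
        ∑ r ∈ Finset.range m, Complex.exp (2 * π * I * k * r / m) := by
      refine Finset.sum_congr rfl fun r _ => ?_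
      congr 1; push_cast; ring
    rw [this, sum_range_exp_eq m hm k, hg]
    dsimp only
    split_ifs <;> ring
  rw [H'.tsum_eq.symm, tsum_mul_left]
  congr 1
  have hinj : Function.Injective fun j : ℤ => j * m :=
    mul_left_injective₀ (by exact_mod_cast hm.ne')
  have hsupp : Function.support g ⊆ Set.range fun j : ℤ => j * m := by
    intro k hk
    rw [Function.mem_support, hg] at hk
    dsimp only at hk
    by_cases hdk : (m : ℤ) ∣ k
    · obtain ⟨j, rfl⟩ := hdk
      exact ⟨j, by simp [mul_comm]⟩
    · exact absurd (if_neg hdk) hk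
  rw [← hinj.tsum_eq hsupp]
  refine tsum_congr fun j => ?_
  simp [hg]

/-- The totient as a Möbius sum: `φ(c) = ∑_{d ∣ c} μ(d) (c/d)`. [folklore] -/
theorem totient_eq_sum_moebius_mul_div (c : ℕ) (hc : 0 < c) :
    (Nat.totient c : ℂ) = ∑ d ∈ c.divisors, (μ d : ℂ) * ((c / d : ℕ) : ℂ) := by
  have key : ∀ n > 0, ∑ x ∈ n.divisorsAntidiagonal, (μ x.fst : ℤ) • ((x.snd : ℕ) : ℤ) =
      (Nat.totient n : ℤ) := by
    refine (ArithmeticFunction.sum_eq_iff_sum_smul_moebius_eq (R := ℤ)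
      (f := fun n => (Nat.totient n : ℤ)) (g := fun n => ((n : ℕ) : ℤ))).mp ?_
    intro n _
    exact_mod_cast Nat.sum_totient n
  have h := key c hc
  rw [Nat.sum_divisorsAntidiagonal (f := fun a b => (μ a : ℤ) • ((b : ℕ) : ℤ))] at h
  have h' := congrArg (fun z : ℤ => (z : ℂ)) h
  simp only [zsmul_eq_mul, Int.cast_id, Int.cast_sum, Int.cast_mul, Int.cast_natCast] at h'
  exact h'.symm

/-- **Sums over reduced residues.** If `h(θ) = ∑_k b_k e(kθ)` pointwise, then for `c ≥ 1`,
`∑_{a mod c, (a,c)=1} h(a/c) = ∑_{d ∣ c} μ(d) (c/d) ∑_{j ∈ ℤ} b_{j c/d}`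
(Möbius inversion of the coprimality condition followed by `sum_range_eq_mul_tsum`; with
`b = ` Fourier coefficients this is the evaluation of Ramanujan sums, Iwaniec (2.26),
Hardy–Wright Thm. 271, in disguise). [cite: Iwaniec2002, (2.26)] -/
theorem sum_coprime_eq {b : ℤ → ℂ} {h : ℝ → ℂ}
    (hh : ∀ θ : ℝ, HasSum (fun k : ℤ => b k * Complex.exp (2 * π * I * k * θ)) (h θ))
    {c : ℕ} (hc : 0 < c) :
    ∑ a ∈ (Finset.range c).filter (fun a => Nat.Coprime c a), h (a / c) =
      ∑ d ∈ c.divisors, (μ d : ℂ) * (((c / d : ℕ) : ℂ) * ∑' j : ℤ, b (j * (c / d : ℕ))) := by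
  classical
  -- coprimality as a Möbius sum
  have hind : ∀ a : ℕ, (if Nat.Coprime c a then (1 : ℂ) else 0) =
      ∑ d ∈ c.divisors, if d ∣ a then (μ d : ℂ) else 0 := by
    intro a
    -- `∑_{d ∣ n} μ(d) = [n = 1]` (Mathlib's `ζ * μ = 1` evaluated at `n = gcd(c, a)`; also the
    -- tree's `Literature.NumberTheory.Sieve.MontgomeryVaughan1975.sum_divisors_moebius_eq`, not imported to keep imports light)
    have h1 : ∑ d ∈ (Nat.gcd c a).divisors, (μ d : ℂ) = if Nat.gcd c a = 1 then 1 else 0 := by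
      have h := congrArg (fun f : ArithmeticFunction ℂ => f (Nat.gcd c a))
        (ArithmeticFunction.coe_zeta_mul_coe_moebius (R := ℂ))
      simpa only [ArithmeticFunction.coe_zeta_mul_apply, ArithmeticFunction.intCoe_apply,
        ArithmeticFunction.one_apply] using h
    have hg : (Nat.gcd c a).divisors = c.divisors.filter (· ∣ a) := by
      ext d
      simp only [Nat.mem_divisors, Finset.mem_filter, Nat.dvd_gcd_iff, ne_eq,
        Nat.gcd_eq_zero_iff, hc.ne', false_and, not_false_eq_true, and_true]
    rw [hg, Finset.sum_filter] at h1
    rw [h1]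
  rw [Finset.sum_filter]
  have e1 : ∀ a ∈ Finset.range c, (if Nat.Coprime c a then h (a / c) else 0) =
      ∑ d ∈ c.divisors, if d ∣ a then (μ d : ℂ) * h (a / c) else 0 := by
    intro a _
    have := hind a
    calc (if Nat.Coprime c a then h (a / c) else 0)
        = (if Nat.Coprime c a then (1 : ℂ) else 0) * h (a / c) := by split_ifs <;> simp
      _ = (∑ d ∈ c.divisors, if d ∣ a then (μ d : ℂ) else 0) * h (a / c) := by rw [this]
      _ = ∑ d ∈ c.divisors, if d ∣ a then (μ d : ℂ) * h (a / c) else 0 := by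
          rw [Finset.sum_mul]
          refine Finset.sum_congr rfl fun d _ => ?_
          split_ifs <;> simp
  rw [Finset.sum_congr rfl e1, Finset.sum_comm]
  refine Finset.sum_congr rfl fun d hd => ?_
  have hd0 : 0 < d := Nat.pos_of_mem_divisors hd
  have hdc : d ∣ c := Nat.dvd_of_mem_divisors hd
  have hcd0 : 0 < c / d := Nat.div_pos (Nat.le_of_dvd hc hdc) hd0
  rw [← Finset.sum_filter]
  -- the multiples of `d` below `c`
  have himage : (Finset.range c).filter (fun a => d ∣ a) =
      (Finset.range (c / d)).image (fun r => d * r) := by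
    ext a
    simp only [Finset.mem_filter, Finset.mem_range, Finset.mem_image]
    constructor
    · rintro ⟨ha, ⟨r, rfl⟩⟩
      refine ⟨r, ?_, rfl⟩
      have := Nat.div_lt_div_of_lt_of_dvd hdc ha
      rwa [Nat.mul_div_cancel_left r hd0] at this
    · rintro ⟨r, hr, rfl⟩
      refine ⟨?_, dvd_mul_right d r⟩
      calc d * r < d * (c / d) := Nat.mul_lt_mul_of_pos_left hr hd0
        _ = c := Nat.mul_div_cancel' hdc
  have hinj : Set.InjOn (fun r => d * r) (Finset.range (c / d) : Set ℕ) :=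
    fun x _ y _ hxy => Nat.eq_of_mul_eq_mul_left hd0 hxy
  rw [himage, Finset.sum_image hinj]
  have e2 : ∀ r ∈ Finset.range (c / d), (μ d : ℂ) * h ((d * r : ℕ) / c) =
      (μ d : ℂ) * h (r / (c / d : ℕ)) := by
    intro r _
    congr 2
    rw [Nat.cast_div hdc (by exact_mod_cast hd0.ne')]
    have hd' : (d : ℝ) ≠ 0 := by exact_mod_cast hd0.ne'
    have hc' : (c : ℝ) ≠ 0 := by exact_mod_cast hc.ne'
    push_cast
    field_simp
  rw [Finset.sum_congr rfl e2, ← Finset.mul_sum, sum_range_eq_mul_tsum hh hcd0]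

/-! ### The bound for rapidly decaying coefficients -/

/-- `∑_{j ∈ ℤ} 1/j² ≤ 4` (crude). [folklore] -/
theorem tsum_one_div_int_sq_le : ∑' j : ℤ, 1 / ((j : ℝ)) ^ 2 ≤ 4 := by
  have h1 : Summable fun n : ℕ => 1 / ((n : ℤ) : ℝ) ^ 2 := by
    simp only [Int.cast_natCast]
    exact Real.summable_one_div_nat_pow.mpr one_lt_two
  have h2 : Summable fun n : ℕ => 1 / ((-(n + 1 : ℤ) : ℤ) : ℝ) ^ 2 := by
    have := (summable_nat_add_iff (f := fun n : ℕ => 1 / (n : ℝ) ^ 2) 1).mpr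
      (Real.summable_one_div_nat_pow.mpr one_lt_two)
    refine this.congr fun n => ?_
    push_cast; ring
  rw [tsum_of_nat_of_neg_add_one (f := fun j : ℤ => 1 / (j : ℝ) ^ 2) h1 h2]
  have b1 : ∑' n : ℕ, 1 / ((n : ℤ) : ℝ) ^ 2 ≤ 2 := by
    refine Real.tsum_le_of_sum_range_le (fun _ => by positivity) fun n => ?_
    rcases Nat.eq_zero_or_pos n with rfl | hn
    · simp
    have := sum_Ioo_inv_sq_le (α := ℝ) 0 n
    rw [Finset.range_eq_Ico, Finset.sum_eq_sum_Ico_succ_bot hn]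
    have h0 : (1 : ℝ) / (((0 : ℕ) : ℤ) : ℝ) ^ 2 = 0 := by simp
    rw [h0, zero_add]
    calc ∑ i ∈ Finset.Ico 1 n, 1 / (((i : ℕ) : ℤ) : ℝ) ^ 2
        = ∑ i ∈ Finset.Ioo 0 n, ((i : ℝ) ^ 2)⁻¹ := by
          refine Finset.sum_congr (by ext i; simp only [Finset.mem_Ico, Finset.mem_Ioo]; omega)
            fun i _ => ?_
          simp
      _ ≤ 2 / (0 + 1) := by exact_mod_cast this
      _ = 2 := by norm_num
  have b2 : ∑' n : ℕ, 1 / ((-(n + 1 : ℤ) : ℤ) : ℝ) ^ 2 ≤ 2 := by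
    refine Real.tsum_le_of_sum_range_le (fun _ => by positivity) fun n => ?_
    have := sum_Ioo_inv_sq_le (α := ℝ) 0 (n + 1)
    have e : ∑ i ∈ Finset.range n, 1 / ((-(i + 1 : ℤ) : ℤ) : ℝ) ^ 2 =
        ∑ i ∈ Finset.Ioo 0 (n + 1), ((i : ℝ) ^ 2)⁻¹ := by
      rw [show Finset.Ioo 0 (n + 1) = Finset.Ico 1 (n + 1) by
        ext i; simp only [Finset.mem_Ico, Finset.mem_Ioo]; omega, Finset.sum_Ico_eq_sum_range]
      simp only [add_tsub_cancel_right, one_div]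
      refine Finset.sum_congr rfl fun i _ => ?_
      push_cast; ring
    rw [e]
    calc ∑ i ∈ Finset.Ioo 0 (n + 1), ((i : ℝ) ^ 2)⁻¹ ≤ 2 / (0 + 1) := by exact_mod_cast this
      _ = 2 := by norm_num
  linarith

/-- `∑_{e ∣ c} 1/e² ≤ 2`. [folklore] -/
theorem sum_divisors_one_div_sq_le (c : ℕ) : ∑ e ∈ c.divisors, 1 / ((e : ℝ)) ^ 2 ≤ 2 := by
  have hsub : c.divisors ⊆ Finset.Ioo 0 (c + 1) := fun e he => by
    rw [Finset.mem_Ioo]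
    exact ⟨Nat.pos_of_mem_divisors he, Nat.lt_succ_of_le (Nat.divisor_le he)⟩
  calc ∑ e ∈ c.divisors, 1 / ((e : ℝ)) ^ 2 ≤ ∑ e ∈ Finset.Ioo 0 (c + 1), 1 / ((e : ℝ)) ^ 2 :=
        Finset.sum_le_sum_of_subset_of_nonneg hsub fun _ _ _ => by positivity
    _ = ∑ e ∈ Finset.Ioo 0 (c + 1), ((e : ℝ) ^ 2)⁻¹ := by simp
    _ ≤ 2 / (0 + 1) := by exact_mod_cast sum_Ioo_inv_sq_le (α := ℝ) 0 (c + 1)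
    _ = 2 := by norm_num

/-- **Reduced-residue sums of a smooth periodic function.** If `h(θ) = ∑_k b_k e(kθ)` with
`‖b_k‖ ≤ M/|k|³` for `k ≠ 0`, then for every `c ≥ 1`,
`‖∑_{a mod c, (a,c)=1} h(a/c) - φ(c) b_0‖ ≤ 8 M` (uniformly in `c`). [folklore] -/
theorem norm_sum_coprime_sub_le {b : ℤ → ℂ} {h : ℝ → ℂ} {M : ℝ}
    (hh : ∀ θ : ℝ, HasSum (fun k : ℤ => b k * Complex.exp (2 * π * I * k * θ)) (h θ))
    (hb : Summable b) (hM : ∀ k : ℤ, k ≠ 0 → ‖b k‖ ≤ M / |(k : ℝ)| ^ 3) {c : ℕ} (hc : 0 < c) :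
    ‖∑ a ∈ (Finset.range c).filter (fun a => Nat.Coprime c a), h (a / c) -
      (Nat.totient c : ℂ) * b 0‖ ≤ 8 * M := by
  classical
  have hM0 : 0 ≤ M := by
    have := hM 1 one_ne_zero
    simp only [Int.cast_one, abs_one, one_pow, div_one] at this
    exact (norm_nonneg _).trans this
  rw [sum_coprime_eq hh hc, totient_eq_sum_moebius_mul_div c hc, Finset.sum_mul,
    ← Finset.sum_sub_distrib]
  -- per divisor
  have hper : ∀ d ∈ c.divisors,
      ‖(μ d : ℂ) * (((c / d : ℕ) : ℂ) * ∑' j : ℤ, b (j * (c / d : ℕ))) -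
        (μ d : ℂ) * ((c / d : ℕ) : ℂ) * b 0‖ ≤ 4 * M * (1 / ((c / d : ℕ) : ℝ) ^ 2) := by
    intro d hd
    have hd0 : 0 < d := Nat.pos_of_mem_divisors hd
    have hdc : d ∣ c := Nat.dvd_of_mem_divisors hd
    set e : ℕ := c / d with he
    have he0 : 0 < e := Nat.div_pos (Nat.le_of_dvd hc hdc) hd0
    have he0' : (0 : ℝ) < e := by exact_mod_cast he0
    have hse : Summable fun j : ℤ => b (j * e) :=
      hb.comp_injective (mul_left_injective₀ (by exact_mod_cast he0.ne'))
    have hsplit := hse.tsum_eq_add_tsum_ite 0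
    simp only [zero_mul] at hsplit
    -- tail bound
    have hbd : ∀ j : ℤ, ‖(if j = 0 then 0 else b (j * e))‖ ≤
        M / (e : ℝ) ^ 3 * (1 / (j : ℝ) ^ 2) := by
      intro j
      split_ifs with hj
      · simp [hj]
      · have h1 := hM (j * e) (mul_ne_zero hj (by exact_mod_cast he0.ne'))
        refine h1.trans ?_
        have hj1 : (1 : ℝ) ≤ |(j : ℝ)| := by
          rw [← Int.cast_abs]; exact_mod_cast Int.one_le_abs hj
        have hj0 : (0 : ℝ) < |(j : ℝ)| := lt_of_lt_of_le one_pos hj1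
        have hpow : |(j : ℝ)| ^ 2 ≤ |(j : ℝ)| ^ 3 := pow_le_pow_right₀ hj1 (by norm_num)
        calc M / |((j * e : ℤ) : ℝ)| ^ 3 = M / (|(j : ℝ)| ^ 3 * (e : ℝ) ^ 3) := by
              rw [Int.cast_mul, Int.cast_natCast, abs_mul, abs_of_pos he0', mul_pow]
          _ ≤ M / (|(j : ℝ)| ^ 2 * (e : ℝ) ^ 3) := by gcongr
          _ = M / (e : ℝ) ^ 3 * (1 / (j : ℝ) ^ 2) := by rw [← sq_abs (j : ℝ)]; field_simp
    have hsq : Summable fun j : ℤ => M / (e : ℝ) ^ 3 * (1 / (j : ℝ) ^ 2) :=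
      (Real.summable_one_div_int_pow.mpr one_lt_two).mul_left _
    have hsn : Summable fun j : ℤ => ‖(if j = 0 then 0 else b (j * e))‖ :=
      Summable.of_nonneg_of_le (fun _ => norm_nonneg _) hbd hsq
    have htail : ‖∑' j : ℤ, (if j = 0 then 0 else b (j * e))‖ ≤ M / (e : ℝ) ^ 3 * 4 := by
      calc ‖∑' j : ℤ, (if j = 0 then 0 else b (j * e))‖
          ≤ ∑' j : ℤ, ‖(if j = 0 then 0 else b (j * e))‖ := norm_tsum_le_tsum_norm hsn
        _ ≤ ∑' j : ℤ, M / (e : ℝ) ^ 3 * (1 / (j : ℝ) ^ 2) := Summable.tsum_le_tsum hbd hsn hsq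
        _ = M / (e : ℝ) ^ 3 * ∑' j : ℤ, 1 / (j : ℝ) ^ 2 := tsum_mul_left
        _ ≤ M / (e : ℝ) ^ 3 * 4 := by gcongr; exact tsum_one_div_int_sq_le
    -- assemble
    have e1 : (μ d : ℂ) * ((e : ℂ) * ∑' j : ℤ, b (j * e)) - (μ d : ℂ) * (e : ℂ) * b 0 =
        (μ d : ℂ) * (e : ℂ) * ∑' j : ℤ, (if j = 0 then 0 else b (j * e)) := by
      rw [hsplit]; ring
    rw [e1, norm_mul, norm_mul, Complex.norm_natCast, Complex.norm_intCast]
    have hμ : |((μ d : ℤ) : ℝ)| ≤ 1 := by exact_mod_cast ArithmeticFunction.abs_moebius_le_one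
    calc |((μ d : ℤ) : ℝ)| * e * ‖∑' j : ℤ, (if j = 0 then 0 else b (j * e))‖
        ≤ 1 * e * (M / (e : ℝ) ^ 3 * 4) := by gcongr
      _ = 4 * M * (1 / (e : ℝ) ^ 2) := by field_simp
  calc ‖∑ d ∈ c.divisors, ((μ d : ℂ) * (((c / d : ℕ) : ℂ) * ∑' j : ℤ, b (j * (c / d : ℕ))) -
        (μ d : ℂ) * ((c / d : ℕ) : ℂ) * b 0)‖
      ≤ ∑ d ∈ c.divisors, ‖(μ d : ℂ) * (((c / d : ℕ) : ℂ) * ∑' j : ℤ, b (j * (c / d : ℕ))) -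
        (μ d : ℂ) * ((c / d : ℕ) : ℂ) * b 0‖ := norm_sum_le _ _
    _ ≤ ∑ d ∈ c.divisors, 4 * M * (1 / ((c / d : ℕ) : ℝ) ^ 2) := Finset.sum_le_sum hper
    _ = 4 * M * ∑ d ∈ c.divisors, 1 / ((d : ℕ) : ℝ) ^ 2 := by
        rw [← Finset.mul_sum, Nat.sum_div_divisors c (fun d => 1 / ((d : ℕ) : ℝ) ^ 2)]
    _ ≤ 4 * M * 2 := by gcongr; exact sum_divisors_one_div_sq_le c
    _ = 8 * M := by ring

end CoprimeResidueSums

end Literature.NumberTheory.LFunctions
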